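import Literature.AnabelianGeometry.EtaleTheta.FrobenioidThetaDivisorSupportQPrincipal
import Literature.AnabelianGeometry.EtaleTheta.Discharge.Sec5Prop53F1OfBiKummerData
import Literature.AnabelianGeometry.EtaleTheta.Discharge.Sec3TemperedFrobenioidNotGroupLike
import HarnessLib

/-!
# [EtTh] §5, Prop. 5.3 (i)–(vi) AT THE GENUINE §5 DATA `ofConnectedTemperoidData` over `B^temp(Π^tp_X)⁰` — the perfect-`Φ`
# capstone with F1, F1-Aut, F1-Ψ's [FrdI] inputs and `hN` DISCHARGED; one displayed sentence (PROOF-ONLY; 0 definitions)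

S. Mochizuki, *The étale theta function and its Frobenioid-theoretic manifestations*, Publ. RIMS **45** (2009), Prop. 5.3
pp. 325–326 (PDF pp. 99–100), proof pp. 326–327 [cite: MochizukiEtTh2009, Prop 5.3 p.325–326 (PDF pp.99–100)]; S. Mochizuki,
*The geometry of Frobenioids I* (2008), Thm. 3.4 (ii)(iii)(v) pp. 62–63, Thm. 4.9 p. 88, Thm. 5.2 (ii) p. 101
[cite: MochizukiFrdI2008, Thm. 4.9 p.88] [cite: MochizukiFrdI2008, Thm. 5.2 (ii) p.101].

abc-iut cell, layer L2 (node family `EtTh:Prop5.3(i)–(vi)`, OUTSIDE the [IUTchIII] Cor. 3.12 cone), seat abc-iut-w5-d123 (gen 9),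
L2-lead ROWS #133 R1040 M1 census follow-on «P53-CAPSTONE@GENUINE».  Everything BY NAME, nothing restated: abc-iut-L6-d1's
perfect-`Φ` capstone `DivisorSupportDataQ.geometryOfDivisorsPreserved_of_principalQ` (p447501) and its F1 binders at the
genuine data `ThetaFrobenioid.gpMap_psiPhi_mem_principalDivisors_iff_ofConnectedTemperoidData` /
`…gpMap_pullAut_mem_principalDivisors_iff_ofConnectedTemperoidData` (p458005 — [FrdI] Thm. 3.4 (ii)(iii)(v), isometries, FSM-type
base, slimness all THEOREMS there), and abc-iut-w4-d008's `BiKummerSetting.exists_not_isGroupLikeObj` ([EtTh] Def. 3.6 (ii)(b):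
no object of a tempered Frobenioid is group-like) for the binder `hN`.

WHAT IS PROVED.  `ThetaFrobenioid.geometryOfDivisorsPreserved_ofConnectedTemperoidData`: for the assembled §5 data
`𝔉 := ofConnectedTemperoidData …` over the genuine connected base `B^temp(Π^tp_X)⁰`, EVERY self-equivalence `Ψ`, chosen
`ι : Ψ(A_⊚) ⥲ A_⊚` and `Ψ`-INDUCED `e` ([FrdI] Thm. 4.9, `induced`), and every perfect-`Φ` support datum `𝔖` over a divisor-geometry
datum `𝔓` whose F1 field IS print's «image of the birational function monoid» (`𝔖.principal = principalDivisors 𝔉.pre A_⊚`):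
`GeometryOfDivisorsPreserved (DivisorTransportStub.ofThm49 𝔉) 𝔓 Ψ ι e` — all six parts of Prop. 5.3 — MODULO EXACTLY
{(i) as typed (`hi`, print's «follows immediately from Corollary 3.8, (iii)»), cusp-Aut (`hAc`), `Φ` non-dilating (`hnd`, a theorem at
the canonical weak vocabulary), the model hypotheses `h` ([FrdI] Thm. 5.2), the integral intersection-theory binder `hI` («the
well-known intersection theory of divisors supported on the chain of copies of the projective line», p.326) and, for (vi), the profile
of `div(Θ̈)` (`θ`, `s`, `hθ`, `hdiv`: Prop. 1.4 (i))}.  GONE relative to the capstone's display at an abstract §5 datum: F1-Ψ (`hP`),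
F1-Aut (`hAP`), `hN`; relative to `geometryOfDivisorsPreserved_of_principalDivisors` (p456668): `hpre`/`hbe`/`hpre′`/`hbe′`/`hiso`.
HONEST FRAMING: a kernel-checked composition of landed theorems about OUR typed §5 data; no `DivisorPrimeData`/`DivisorSupportDataQ`
at the genuine data is constructed here (the special fibre of `Ÿ` has no carrier, plan/FOUNDATIONS.md row 14) — they are displayed
junction data; nothing of [EtTh] is asserted for an actual curve; typed ≠ proved; no side taken on [IUTchIII] Cor. 3.12.
-/

namespace Literature.AnabelianGeometry.EtaleTheta

open CategoryTheory Opposite Literature.AlgebraicGeometry.Frobenioids Literature.AnabelianGeometry.SemiGraphs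
  FrobenioidThetaDivisors

namespace ThetaFrobenioid

universe u₀ v₀ w

section ConnectedTemperoidData

variable {K : Type u₀} [Field K] {X : SemiGraphs.TemperedArithmeticGroup.{u₀} K} {D₀ : Type u₀} [Category.{v₀} D₀]
  {V : FrdIMonoidStub.{w}} {T₀ : RealifiedDivisorMonoids (D₀ := D₀) V}
  {VD : FrdICatStub.{u₀ + 1, u₀, w} (ConnectedPart (BTemp X.Pi))}
  {tf : TemperedFrobenioid T₀ (ConnectedPart (BTemp X.Pi)) VD} {hZ : tf.monoidType = MonoidType.Z}
  {hP : ∀ A : (ConnectedPart (BTemp X.Pi))ᵒᵖ, IsPerfect (tf.Φ.carrier A)}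
  {NH : Subgroup (Field.absoluteGaloisGroup K) → tf.category → ℕ+ → Prop} {A₀ : tf.category}
  {hA₀ : PreFrobenioid.IsFrobeniusTrivial tf.toElem A₀} {hA₀' : SemiGraphs.IsGaloisObj A₀.base.obj}
  {pullFrac : ∀ {A A' : (BiKummerSetting.mkOfConnectedTemperoid X tf hZ hP NH A₀ hA₀ hA₀').C} (_ : A' ⟶ A),
    (BiKummerSetting.mkOfConnectedTemperoid X tf hZ hP NH A₀ hA₀ hA₀').biratUnits A →
      (BiKummerSetting.mkOfConnectedTemperoid X tf hZ hP NH A₀ hA₀ hA₀').biratUnits A'}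
  {lv N : ℕ+} {T : ThetaEnvData.{max u₀ w} N}
  {θ : (BiKummerSetting.mkOfConnectedTemperoid X tf hZ hP NH A₀ hA₀ hA₀').biratUnits
    (BiKummerSetting.mkOfConnectedTemperoid X tf hZ hP NH A₀ hA₀ hA₀').Aodot}
  {Bl : (BiKummerSetting.mkOfConnectedTemperoid X tf hZ hP NH A₀ hA₀ hA₀').C}
  {Pl : (BiKummerSetting.mkOfConnectedTemperoid X tf hZ hP NH A₀ hA₀ hA₀').FractionPair θ Bl}
  {Rl : (BiKummerSetting.mkOfConnectedTemperoid X tf hZ hP NH A₀ hA₀ hA₀').NthRoot θ Pl lv pullFrac}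
  (h : ModelFrobenioid.Hypotheses tf.divisorMonoid tf.ratFnFunctor)
  (Q : FrobenioidTheta.ThetaSubquotientStub.{w} (ConnectedPart (BTemp X.Pi))) (odd_l : Odd (lv : ℕ))
  (R : (BiKummerSetting.mkOfConnectedTemperoid X tf hZ hP NH A₀ hA₀ hA₀').NthRoot Rl.root Rl.pair N pullFrac)
  (ιX : T.PiX ≃ₜ* X.Pi) (K' : Type w) [Field K'] (constEmb : K'ˣ →* tf.biratUnitsModel R.BN)
  (constEmb_injective : Function.Injective constEmb)
  (hinvc : ∀ g : Aut R.AN.base,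
    pull tf.divisorMonoid g.hom (ModelFrobenioid.div R.pair.num) = ModelFrobenioid.div R.pair.num)
  (hinvp : ∀ y : T.PiX, y ∈ T.PiYdd →
    pull tf.divisorMonoid ((BiKummerSetting.mkOfConnectedTemperoid X tf hZ hP NH A₀ hA₀ hA₀').galoisSurj R.AN.base
      R.αData.isGalois (ιX y)).hom (ModelFrobenioid.div R.pair.den) = ModelFrobenioid.div R.pair.den)

include h in
/-- **[EtTh] Prop. 5.3 (i)–(vi) at the genuine §5 data `𝔉 := ofConnectedTemperoidData …` over `B^temp(Π^tp_X)⁰`**, for every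
self-equivalence `Ψ`, chosen `ι : Ψ(A_⊚) ⥲ A_⊚`, `Ψ`-induced `e`, and every perfect-`Φ` support datum `𝔖` over `𝔓` with
`𝔖.principal = principalDivisors 𝔉.pre A_⊚` (print's F1): `GeometryOfDivisorsPreserved (ofThm49 𝔉) 𝔓 Ψ ι e` MODULO EXACTLY
{`hi` (i) as typed — Cor. 3.8 (iii); `hAc` cusp-Aut; `hnd`; `h`; `hI`; the `div(Θ̈)` profile `θ`/`s`/`hθ`/`hdiv` (Prop. 1.4 (i))} —
F1-Ψ and F1-Aut supplied by p458005, `hN` by `BiKummerSetting.exists_not_isGroupLikeObj`.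
[cite: MochizukiEtTh2009, Prop 5.3 p.325–326 (PDF pp.99–100)] [cite: MochizukiFrdI2008, Thm. 4.9 p.88] -/
theorem geometryOfDivisorsPreserved_ofConnectedTemperoidData (hnd : IsNonDilatingOn tf.divisorMonoid)
    (Ψ : (BiKummerSetting.mkOfConnectedTemperoid X tf hZ hP NH A₀ hA₀ hA₀').C ≌
      (BiKummerSetting.mkOfConnectedTemperoid X tf hZ hP NH A₀ hA₀ hA₀').C)
    (ι : Ψ.functor.obj (ofConnectedTemperoidData h Q odd_l R ιX K' constEmb constEmb_injective hinvc hinvp).Acirc ≅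
      (ofConnectedTemperoidData h Q odd_l R ιX K' constEmb constEmb_injective hinvc hinvp).Acirc)
    {e : (ofConnectedTemperoidData h Q odd_l R ιX K' constEmb constEmb_injective hinvc hinvp).PhiAcirc ≃*
      (ofConnectedTemperoidData h Q odd_l R ιX K' constEmb constEmb_injective hinvc hinvp).pre.Mon
        ((ofConnectedTemperoidData h Q odd_l R ιX K' constEmb constEmb_injective hinvc hinvp).base.obj
          (Ψ.functor.obj (ofConnectedTemperoidData h Q odd_l R ιX K' constEmb constEmb_injective hinvc hinvp).Acirc))}
    (induced : (DivisorTransportStub.ofThm49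
      (ofConnectedTemperoidData h Q odd_l R ιX K' constEmb constEmb_injective hinvc hinvp)).IsInducedBy Ψ
        (ofConnectedTemperoidData h Q odd_l R ιX K' constEmb constEmb_injective hinvc hinvp).Acirc e)
    {𝔓 : DivisorPrimeData (ofConnectedTemperoidData h Q odd_l R ιX K' constEmb constEmb_injective hinvc hinvp)}
    (𝔖 : DivisorSupportDataQ 𝔓)
    (h𝔖 : 𝔖.principal =
      principalDivisors (ofConnectedTemperoidData h Q odd_l R ιX K' constEmb constEmb_injective hinvc hinvp).pre
        (ofConnectedTemperoidData h Q odd_l R ιX K' constEmb constEmb_injective hinvc hinvp).Acirc)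
    (hi : PreservesCuspidality
      (DivisorTransportStub.ofThm49 (ofConnectedTemperoidData h Q odd_l R ιX K' constEmb constEmb_injective hinvc hinvp))
      𝔓 Ψ ι e)
    (hI : 𝔖.PrincipalIffIntegralDegreeZero)
    (θ₀ : ℤ → ℚ) (s : ℤ) (hθ : ∀ j, θ₀ (s - j) = θ₀ j)
    (hdiv : ∀ (𝔫 : Primes (ofConnectedTemperoidData h Q odd_l R ιX K' constEmb constEmb_injective hinvc hinvp).PhiAcirc)
      (h𝔫 : ¬ 𝔓.IsCuspidal 𝔫), 𝔖.ord 𝔫 𝔓.divTheta = θ₀ (𝔓.ncspEquivZ ⟨𝔫, h𝔫⟩))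
    (hAc : ∀ (g : Aut (ofConnectedTemperoidData h Q odd_l R ιX K' constEmb constEmb_injective hinvc hinvp).Acirc)
      (𝔭 : Primes (ofConnectedTemperoidData h Q odd_l R ιX K' constEmb constEmb_injective hinvc hinvp).PhiAcirc),
      𝔓.IsCuspidal (Primes.congr
        ((ofConnectedTemperoidData h Q odd_l R ιX K' constEmb constEmb_injective hinvc hinvp).pullAut g) 𝔭) ↔
        𝔓.IsCuspidal 𝔭) :
    GeometryOfDivisorsPreserved
      (DivisorTransportStub.ofThm49 (ofConnectedTemperoidData h Q odd_l R ιX K' constEmb constEmb_injective hinvc hinvp))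
      𝔓 Ψ ι e := by
  refine 𝔖.geometryOfDivisorsPreserved_of_principalQ Ψ ι e _ induced hi (fun x => ?_) hI θ₀ s hθ hdiv hAc (fun g x => ?_)
  · rw [h𝔖]
    exact gpMap_psiPhi_mem_principalDivisors_iff_ofConnectedTemperoidData h Q odd_l R ιX K' constEmb constEmb_injective
      hinvc hinvp hnd (BiKummerSetting.exists_not_isGroupLikeObj _) Ψ ι induced x
  · rw [h𝔖]
    exact gpMap_pullAut_mem_principalDivisors_iff_ofConnectedTemperoidData h Q odd_l R ιX K' constEmb constEmb_injective
      hinvc hinvp g x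

end ConnectedTemperoidData

end ThetaFrobenioid

end Literature.AnabelianGeometry.EtaleTheta
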